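import Literature.Computability.AlgebraicComplexity.GMQ16PDefinableDegenerations
import Literature.Computability.AlgebraicComplexity.IMMInVPProofs
import Literature.Computability.AlgebraicComplexity.RootLifting
import HarnessLib

/-!
# Grochow–Mulmuley–Qiao 2016, Lemma 4.3 BY NAME: `lemma_4_3_holds`
# (one-parameter degenerations of polynomial degree of `VP` families stay in `VP`)

Theorem-only file (no definitions, no named facts; census −1: the x-row fact `GMQ2016.lemma_4_3` of
`GMQ16PDefinableDegenerations.lean` is DISCHARGED BY NAME). Source: J. A. Grochow, K. D. Mulmuley,
Y. Qiao, *Boundaries of VP and VNP*, ICALP 2016, arXiv:1605.02815 [GrochowMulmuleyQiao2016],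
Lemma 4.3 (p. 12: "If `{f_n}` is a one-parameter degeneration of `{g_n} ∈ VP` of polynomial degree,
then `{f_n} ∈ VP`. Bürgisser [Bür04] proves this using interpolation (Bini–Strassen)").

## What is proved

* `GMQ2016.totalDegree_le_of_isLimit` — a limit `f = lim_{t→0} g(y(t))` of an affine substitution
  has `deg f ≤ deg g`.
* `GMQ2016.complexity_le_of_isDegenerationOfDegree` — if moreover the Laurent coefficients of the
  affine forms are supported on `[-K, K]` (`HasDegreeLE K`), then
  `L(f) ≤ (D+1)·((2KD+1)·((D+2)² L(g) + l(m+1)((2K+1)(2K+2)+2) + 2)) + (D+1)`, `D = deg g`,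
  `l` / `m` the numbers of variables of `g` / `f`.
* `GMQ2016.lemma_4_3_holds : lemma_4_3`.

## Proof (Bini–Strassen interpolation, written on the tree's engines)

Write `g = Σ_{e ≤ D} g_e` in homogeneous components (`L(g_e) ≤ (e+2)² L(g)`,
`complexity_homogeneousComponent_le_sq_mul`). Clearing the pole, `t^K a^i_j(t) = P^i_j(t)` are honest
polynomials of degree `≤ 2K`; with a fresh variable `t` (the `none` variable of `Option (Fin m)`) put
`Y_i = P^i_0(t) + Σ_j P^i_j(t) x_j` and `H_e = g_e(Y) ∈ F[t, x]`. Homogeneity gives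
`g_e(t^K y(t)) = t^{Ke} g_e(y(t))`, so the constant Laurent coefficient of `g_e(y(t))` is the
coefficient of `t^{Ke}` in `H_e`, i.e. `f = Σ_e [t^{Ke}] H_e` (`IsLimit`). Each `[t^{Ke}] H_e` is
extracted by interpolation at `deg_t H_e + 1 ≤ 2KD + 1` points (`complexity_coeff_optionEquivLeft_le`,
Dutta–Saxena–Sinhababu 2018 / Bürgisser 2000 Rem. 2.7), and `L(H_e) ≤ L(g_e) + Σ_i L(Y_i)`
(`complexity_aeval_le`). The bookkeeping identity `f = Σ_e [t^{Ke}] H_e` is proved coefficientwise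
through the ring map `F[t][x] → F[t,t⁻¹][x]`, `t ↦ T`.
-/

namespace Literature.Computability.AlgebraicComplexity.GMQ2016

open MvPolynomial LaurentPolynomial Polynomial

/-! ### Laurent-polynomial bookkeeping -/

section Laurent

variable {F : Type*} [CommRing F]

/-- Coefficients of `C r · T^n`. [folklore] -/
private theorem coeff_C_mul_T' (r : F) (n a : ℤ) :
    (LaurentPolynomial.C r * T n).coeff a = if a = n then r else 0 := by
  rw [← single_eq_C_mul_T, AddMonoidAlgebra.coeff_single, Finsupp.single_apply]; simp [eq_comm]

/-- Coefficients of `toLaurent p`. [folklore] -/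
private theorem coeff_toLaurent_ite' (p : F[X]) (a : ℤ) :
    (toLaurent p).coeff a = if 0 ≤ a then p.coeff a.toNat else 0 := by
  induction p using Polynomial.induction_on' with
  | add p q hp hq =>
    simp only [map_add, AddMonoidAlgebra.coeff_add, Finsupp.add_apply, hp, hq, Polynomial.coeff_add]
    split_ifs <;> simp
  | monomial n r =>
    rw [Polynomial.toLaurent_C_mul_T, coeff_C_mul_T', Polynomial.coeff_monomial]
    by_cases h : 0 ≤ a
    · rw [if_pos h]
      by_cases h' : a = n
      · subst h'; simp
      · rw [if_neg h', if_neg (by omega)]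
    · rw [if_neg h, if_neg (by omega)]

/-- Coefficients of `q · T^n`. [folklore] -/
private theorem coeff_mul_T' (q : F[T;T⁻¹]) (n a : ℤ) : (q * T n).coeff a = q.coeff (a - n) := by
  rw [T, AddMonoidAlgebra.coeff_mul_single_eq_coeff_mul (a - n)
    (fun m _ => by constructor <;> intro h <;> omega), mul_one]

/-- Coefficients of `T^n · q`. [folklore] -/
private theorem coeff_T_mul' (q : F[T;T⁻¹]) (n a : ℤ) : (T n * q).coeff a = q.coeff (a - n) := by
  rw [T_mul, coeff_mul_T']

/-- A Laurent polynomial without negative powers is a polynomial. [folklore] -/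
private theorem exists_toLaurent_eq_of_coeff_neg' (q : F[T;T⁻¹])
    (h : ∀ z : ℤ, z < 0 → q.coeff z = 0) : ∃ p : F[X], toLaurent p = q := by
  obtain ⟨n, p', hp'⟩ := exists_T_pow q
  have hdvd : (X : F[X]) ^ n ∣ p' := by
    refine Polynomial.X_pow_dvd_iff.mpr fun d hd => ?_
    have := congrArg (fun x : F[T;T⁻¹] => x.coeff (d : ℤ)) hp'
    simp only [coeff_toLaurent_ite', coeff_mul_T'] at this
    rw [if_pos (by omega), h _ (by omega)] at this
    simpa using this
  obtain ⟨p, rfl⟩ := hdvd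
  refine ⟨p, ?_⟩
  have h2 : toLaurent p * T n = q * T n := by
    rw [← hp', map_mul, Polynomial.toLaurent_X_pow, mul_comm]
  exact (isUnit_T n).mul_left_injective h2

/-- Laurent coefficients are additive over finite sums. [folklore] -/
private theorem laurent_coeff_sum {ι : Type*} (s : Finset ι) (q : ι → F[T;T⁻¹]) (z : ℤ) :
    (∑ i ∈ s, q i).coeff z = ∑ i ∈ s, (q i).coeff z := by
  classical
  induction s using Finset.induction_on with
  | empty => simp
  | insert a s ha ih =>
    rw [Finset.sum_insert ha, Finset.sum_insert ha, AddMonoidAlgebra.coeff_add, Finsupp.add_apply, ih]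

/-- **Clearing the pole**: a Laurent polynomial supported on `[-K, K]` times `T^K` is an honest
polynomial of degree `≤ 2K`. [folklore] -/
private theorem exists_poly_of_hasDegreeLE {l m K : ℕ} {a : Fin l → Option (Fin m) → F[T;T⁻¹]}
    (ha : HasDegreeLE K a) (i : Fin l) (j : Option (Fin m)) :
    ∃ p : F[X], toLaurent p = a i j * T K ∧ p.natDegree ≤ 2 * K := by
  obtain ⟨p, hp⟩ := exists_toLaurent_eq_of_coeff_neg' (a i j * T K) fun z hz => by
    rw [coeff_mul_T']; exact ha i j _ (by omega)
  refine ⟨p, hp, ?_⟩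
  rw [Polynomial.natDegree_le_iff_coeff_eq_zero]
  intro N hN
  have := congrArg (fun x : F[T;T⁻¹] => x.coeff (N : ℤ)) hp
  simp only [coeff_toLaurent_ite', coeff_mul_T', Nat.cast_nonneg, if_true, Int.toNat_natCast] at this
  rw [this]; exact ha i j _ (by omega)

end Laurent

/-! ### Degrees -/

section Degrees

variable {R : Type*} [CommSemiring R]

/-- Substituting polynomials of total degree `≤ N` multiplies the total degree by at most `N`.
[folklore] -/
private theorem totalDegree_aeval_le_mul {σ τ A : Type*} [CommSemiring A] [Algebra R A]
    (s : σ → MvPolynomial τ A) {N : ℕ} (hs : ∀ i, (s i).totalDegree ≤ N) (p : MvPolynomial σ R) :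
    (aeval s p).totalDegree ≤ p.totalDegree * N := by
  classical
  conv_lhs => rw [p.as_sum]
  rw [map_sum]
  refine (totalDegree_finsetSum _ _).trans (Finset.sup_le fun d hd => ?_)
  rw [MvPolynomial.aeval_monomial, MvPolynomial.algebraMap_apply]
  refine (totalDegree_mul _ _).trans ?_
  rw [totalDegree_C, zero_add, Finsupp.prod]
  refine (totalDegree_finsetProd _ _).trans ?_
  refine le_trans (Finset.sum_le_sum fun i _ => (totalDegree_pow _ _).trans
    (Nat.mul_le_mul_left _ (hs i))) ?_
  rw [← Finset.sum_mul]
  exact Nat.mul_le_mul_right _ (le_totalDegree hd)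

/-- Substituting polynomials of `x`-degree `≤ N` multiplies the `x`-degree by at most the total
degree. [folklore] -/
private theorem degreeOf_aeval_le_mul {σ τ : Type*} (x : τ) (s : σ → MvPolynomial τ R) {N : ℕ}
    (hs : ∀ i, (s i).degreeOf x ≤ N) (p : MvPolynomial σ R) :
    (aeval s p).degreeOf x ≤ p.totalDegree * N := by
  classical
  conv_lhs => rw [p.as_sum]
  rw [map_sum]
  refine (degreeOf_sum_le _ _ _).trans (Finset.sup_le fun d hd => ?_)
  rw [MvPolynomial.aeval_monomial, MvPolynomial.algebraMap_eq]
  refine (degreeOf_C_mul_le _ _ _).trans ?_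
  rw [Finsupp.prod]
  refine (degreeOf_prod_le _ _ _).trans ?_
  refine le_trans (Finset.sum_le_sum fun i _ => (degreeOf_pow_le _ _ _).trans
    (Nat.mul_le_mul_left _ (hs i))) ?_
  rw [← Finset.sum_mul]
  exact Nat.mul_le_mul_right _ (le_totalDegree hd)

end Degrees

/-! ### Homogeneity and the ring map `t ↦ T` -/

section Transport

variable {R : Type*} [CommSemiring R]

/-- `g_e(c · y) = c^e · g_e(y)` for the degree-`e` homogeneous component. [folklore] -/
private theorem aeval_mul_homogeneousComponent {σ B : Type*} [CommSemiring B] [Algebra R B]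
    (s : σ → B) (c : B) (p : MvPolynomial σ R) (e : ℕ) :
    aeval (fun i => c * s i) (homogeneousComponent e p) =
      c ^ e * aeval s (homogeneousComponent e p) := by
  classical
  rw [homogeneousComponent_apply, map_sum, map_sum, Finset.mul_sum]
  refine Finset.sum_congr rfl fun d hd => ?_
  rw [Finset.mem_filter] at hd
  rw [MvPolynomial.aeval_monomial, MvPolynomial.aeval_monomial, Finsupp.prod, Finsupp.prod]
  simp_rw [mul_pow]
  rw [Finset.prod_mul_distrib, Finset.prod_pow_eq_pow_sum, ← Finsupp.degree_apply, hd.2]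
  ring

/-- A ring map compatible with the structure maps commutes with `aeval`. [folklore] -/
private theorem ringHom_aeval {σ A B : Type*} [CommSemiring A] [CommSemiring B] [Algebra R A]
    [Algebra R B] (Ψ : A →+* B) (hΨ : ∀ c : R, Ψ (algebraMap R A c) = algebraMap R B c)
    (s : σ → A) (p : MvPolynomial σ R) : Ψ (aeval s p) = aeval (fun i => Ψ (s i)) p := by
  induction p using MvPolynomial.induction_on with
  | C c => simp [hΨ]
  | add p q hp hq => simp [hp, hq]
  | mul_X p i hp => simp [hp]

variable {F : Type*} [CommRing F]

/-- Coefficient extraction through `Λ : F[x][t] → F[t,t⁻¹][x]`, `t ↦ T`: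
`[T^k] (coeff_μ (Λ p)) = coeff_μ ([t^k] p)`. [folklore] -/
private theorem coeff_coeff_evalT {m : ℕ} (p : Polynomial (MvPolynomial (Fin m) F))
    (μ : Fin m →₀ ℕ) (k : ℕ) :
    (coeff μ (Polynomial.eval₂RingHom (MvPolynomial.map LaurentPolynomial.C)
        (MvPolynomial.C (T 1) : MvPolynomial (Fin m) F[T;T⁻¹]) p)).coeff (k : ℤ) =
      coeff μ (p.coeff k) := by
  induction p using Polynomial.induction_on' with
  | add p q hp hq =>
    rw [map_add, MvPolynomial.coeff_add, AddMonoidAlgebra.coeff_add, Finsupp.add_apply, hp, hq,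
      Polynomial.coeff_add, MvPolynomial.coeff_add]
  | monomial n q =>
    rw [Polynomial.coe_eval₂RingHom, Polynomial.eval₂_monomial, ← map_pow, T_pow, mul_one,
      mul_comm, MvPolynomial.coeff_C_mul, MvPolynomial.coeff_map, T_mul, coeff_C_mul_T',
      Polynomial.coeff_monomial]
    by_cases h : n = k
    · subst h; simp
    · rw [if_neg (by exact_mod_cast (Ne.symm h)), if_neg h, MvPolynomial.coeff_zero]

end Transport

/-! ### Cost and `t`-degree of the polynomial-side forms -/

section Cost

variable {F : Type*} [Field F]

/-- `L(x^k) ≤ k`. [folklore] -/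
private theorem complexity_X_pow_le' {σ : Type*} (o : σ) (k : ℕ) :
    complexity (X o ^ k : MvPolynomial σ F) ≤ k := by
  induction k with
  | zero => rw [pow_zero, ← MvPolynomial.C_1, complexity_C_holds (k := F)]
  | succ k ih =>
    rw [pow_succ]
    refine (complexity_mul_le_holds _ _).trans ?_
    rw [complexity_X_holds (k := F)]; omega

/-- A univariate polynomial of degree `≤ N` in the variable `x_o` costs `≤ (N+1)(N+2)`. [folklore] -/
private theorem complexity_aeval_X_le {σ : Type*} (o : σ) {p : F[X]} {N : ℕ} (hp : p.natDegree ≤ N) :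
    complexity (Polynomial.aeval (X o : MvPolynomial σ F) p) ≤ (N + 1) * (N + 2) := by
  rw [Polynomial.aeval_eq_sum_range' (Nat.lt_succ_of_le hp)]
  simp_rw [MvPolynomial.smul_eq_C_mul]
  refine (complexity_finset_sum_le _ _).trans ?_
  have h : ∑ k ∈ Finset.range (N + 1), complexity (MvPolynomial.C (p.coeff k) * X o ^ k :
      MvPolynomial σ F) ≤ ∑ _k ∈ Finset.range (N + 1), (N + 1) := by
    refine Finset.sum_le_sum fun k hk => (complexity_mul_le_holds _ _).trans ?_
    rw [complexity_C_holds (k := F), zero_add]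
    have := complexity_X_pow_le' (F := F) o k
    have hk' := Finset.mem_range.1 hk
    omega
  rw [Finset.sum_const, Finset.card_range, smul_eq_mul] at h
  rw [Finset.card_range]
  nlinarith [h]

/-- The `x_o`-degree of a univariate polynomial of degree `≤ N` in `x_o` is `≤ N`. [folklore] -/
private theorem degreeOf_aeval_X_le {σ : Type*} [DecidableEq σ] (o : σ) {p : F[X]} {N : ℕ}
    (hp : p.natDegree ≤ N) : degreeOf o (Polynomial.aeval (X o : MvPolynomial σ F) p) ≤ N := by
  rw [Polynomial.aeval_eq_sum_range' (Nat.lt_succ_of_le hp)]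
  simp_rw [MvPolynomial.smul_eq_C_mul]
  refine (degreeOf_sum_le _ _ _).trans (Finset.sup_le fun k hk => ?_)
  refine (degreeOf_C_mul_le _ _ _).trans ((degreeOf_pow_le _ _ _).trans ?_)
  rw [degreeOf_X, if_pos rfl, mul_one]
  exact Nat.lt_succ_iff.1 (Finset.mem_range.1 hk)

variable {m : ℕ}

/-- Cost of a polynomial-side affine form `Y = P₀(t) + Σ_j P_j(t) x_j`, `deg P ≤ N`:
`L(Y) ≤ (m+1)((N+1)(N+2)+2)`. [folklore] -/
private theorem complexity_polyForm_le (P : Option (Fin m) → F[X]) {N : ℕ}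
    (hP : ∀ j, (P j).natDegree ≤ N) :
    complexity (Polynomial.aeval (X none : MvPolynomial (Option (Fin m)) F) (P none) +
      ∑ j : Fin m, Polynomial.aeval (X none : MvPolynomial (Option (Fin m)) F) (P (some j)) *
        X (some j)) ≤ (m + 1) * ((N + 1) * (N + 2) + 2) := by
  refine (complexity_add_le_holds _ _).trans ?_
  have h0 := complexity_aeval_X_le (none : Option (Fin m)) (hP none)
  have h1 := complexity_finset_sum_le (Finset.univ : Finset (Fin m)) fun j =>
    Polynomial.aeval (X none : MvPolynomial (Option (Fin m)) F) (P (some j)) * X (some j)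
  have h2 : ∑ j : Fin m, complexity (Polynomial.aeval (X none : MvPolynomial (Option (Fin m)) F)
      (P (some j)) * X (some j)) ≤ ∑ _j : Fin m, ((N + 1) * (N + 2) + 1) := by
    refine Finset.sum_le_sum fun j _ => (complexity_mul_le_holds _ _).trans ?_
    rw [complexity_X_holds (k := F), add_zero]
    exact Nat.add_le_add_right (complexity_aeval_X_le _ (hP (some j))) _
  rw [Finset.sum_const, Finset.card_univ, Fintype.card_fin, smul_eq_mul] at h2
  rw [Finset.card_univ, Fintype.card_fin] at h1
  nlinarith [h0, h1, h2]

/-- `t`-degree of a polynomial-side affine form: `deg_t Y ≤ N`. [folklore] -/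
private theorem degreeOf_polyForm_le (P : Option (Fin m) → F[X]) {N : ℕ}
    (hP : ∀ j, (P j).natDegree ≤ N) :
    degreeOf none (Polynomial.aeval (X none : MvPolynomial (Option (Fin m)) F) (P none) +
      ∑ j : Fin m, Polynomial.aeval (X none : MvPolynomial (Option (Fin m)) F) (P (some j)) *
        X (some j)) ≤ N := by
  classical
  refine (degreeOf_add_le _ _ _).trans (max_le (degreeOf_aeval_X_le _ (hP none)) ?_)
  refine (degreeOf_sum_le _ _ _).trans (Finset.sup_le fun j _ => ?_)
  refine (degreeOf_mul_le _ _ _).trans ?_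
  rw [degreeOf_X, if_neg (Option.some_ne_none j).symm, add_zero]
  exact degreeOf_aeval_X_le _ (hP (some j))

end Cost

/-! ### The per-`n` statements -/

section PerN

/-- The affine forms of a degeneration have total degree `≤ 1`. [folklore] -/
private theorem totalDegree_substForm_le {l m : ℕ} (a : Fin l → Option (Fin m) → ℂ[T;T⁻¹])
    (i : Fin l) : (substForm a i).totalDegree ≤ 1 := by
  unfold substForm
  refine (totalDegree_add _ _).trans (max_le (by rw [totalDegree_C]; exact Nat.zero_le _) ?_)
  refine totalDegree_finsetSum_le fun j _ => (totalDegree_mul _ _).trans ?_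
  rw [totalDegree_C, totalDegree_X, zero_add]

/-- **`deg f ≤ deg g`** for a limit `f = lim_{t→0} g(y(t))` of an affine substitution.
[cite: GrochowMulmuleyQiao2016, §3.3] -/
theorem totalDegree_le_of_isLimit {l m : ℕ} (g : MvPolynomial (Fin l) ℂ)
    (f : MvPolynomial (Fin m) ℂ) (a : Fin l → Option (Fin m) → ℂ[T;T⁻¹])
    (h : IsLimit f (degenerate g a)) : f.totalDegree ≤ g.totalDegree := by
  have hsub : f.support ⊆ (degenerate g a).support := by
    intro μ hμ
    rw [MvPolynomial.mem_support_iff] at hμ ⊢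
    intro h0
    apply hμ
    rw [← (h μ).2, h0]
    rfl
  have h2 : (degenerate g a).totalDegree ≤ g.totalDegree * 1 :=
    totalDegree_aeval_le_mul (substForm a) (totalDegree_substForm_le a) g
  rw [mul_one] at h2
  have h1 : f.totalDegree ≤ (degenerate g a).totalDegree := Finset.sup_mono hsub
  exact h1.trans h2

/-- **Bini–Strassen interpolation bound**: if `f` is a one-parameter degeneration of `g` of degree
`≤ K` (`l` source variables, `m` target variables, `D = deg g`), then
`L(f) ≤ (D+1)·((2KD+1)·((D+2)² L(g) + l(m+1)((2K+1)(2K+2)+2) + 2)) + (D+1)`.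
[cite: GrochowMulmuleyQiao2016, Lemma 4.3 (proof: interpolation)] -/
theorem complexity_le_of_isDegenerationOfDegree {l m K : ℕ} (g : MvPolynomial (Fin l) ℂ)
    (f : MvPolynomial (Fin m) ℂ) (h : IsDegenerationOfDegree K g f) :
    complexity f ≤ (g.totalDegree + 1) * ((2 * K * g.totalDegree + 1) *
      ((g.totalDegree + 2) ^ 2 * complexity g +
        l * (m + 1) * ((2 * K + 1) * (2 * K + 2) + 2) + 2)) + (g.totalDegree + 1) := by
  classical
  obtain ⟨a, ha, hlim⟩ := h
  choose P hP hPdeg using exists_poly_of_hasDegreeLE ha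
  set D := g.totalDegree with hD
  -- polynomial-side forms, their substitution into the homogeneous components, and the extracted
  -- `t^{Ke}` coefficients
  set Y : Fin l → MvPolynomial (Option (Fin m)) ℂ := fun i =>
    Polynomial.aeval (X none : MvPolynomial (Option (Fin m)) ℂ) (P i none) +
      ∑ j : Fin m, Polynomial.aeval (X none : MvPolynomial (Option (Fin m)) ℂ) (P i (some j)) *
        X (some j) with hY
  set H : ℕ → MvPolynomial (Option (Fin m)) ℂ := fun e => MvPolynomial.aeval Y (homogeneousComponent e g) with hH
  set fe : ℕ → MvPolynomial (Fin m) ℂ := fun e => (optionEquivLeft ℂ (Fin m) (H e)).coeff (K * e)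
    with hfe
  -- the ring map `t ↦ T`
  set Λ : Polynomial (MvPolynomial (Fin m) ℂ) →+* MvPolynomial (Fin m) ℂ[T;T⁻¹] :=
    Polynomial.eval₂RingHom (MvPolynomial.map LaurentPolynomial.C)
      (MvPolynomial.C (T 1) : MvPolynomial (Fin m) ℂ[T;T⁻¹]) with hΛ
  set Ψ : MvPolynomial (Option (Fin m)) ℂ →+* MvPolynomial (Fin m) ℂ[T;T⁻¹] :=
    Λ.comp (optionEquivLeft ℂ (Fin m)).toRingEquiv.toRingHom with hΨ
  have hΨapply : ∀ q, Ψ q = Λ (optionEquivLeft ℂ (Fin m) q) := fun q => rfl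
  have hΛC : ∀ q : MvPolynomial (Fin m) ℂ, Λ (Polynomial.C q) = MvPolynomial.map LaurentPolynomial.C q :=
    fun q => by rw [hΛ, Polynomial.coe_eval₂RingHom, Polynomial.eval₂_C]
  have hΛX : Λ Polynomial.X = MvPolynomial.C (T 1) := by
    rw [hΛ, Polynomial.coe_eval₂RingHom, Polynomial.eval₂_X]
  have hΨC : ∀ c : ℂ, Ψ (algebraMap ℂ (MvPolynomial (Option (Fin m)) ℂ) c) =
      algebraMap ℂ (MvPolynomial (Fin m) ℂ[T;T⁻¹]) c := by
    intro c
    rw [hΨapply, MvPolynomial.algebraMap_eq, optionEquivLeft_C, hΛC, MvPolynomial.map_C,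
      MvPolynomial.algebraMap_apply, ← LaurentPolynomial.C_eq_algebraMap]
  have hΨnone : Ψ (X none) = MvPolynomial.C (T 1) := by
    rw [hΨapply, optionEquivLeft_X_none, hΛX]
  have hΨsome : ∀ j : Fin m, Ψ (X (some j)) = X j := by
    intro j; rw [hΨapply, optionEquivLeft_X_some, hΛC, MvPolynomial.map_X]
  have hΨι : ∀ p : ℂ[X], Ψ (Polynomial.aeval (X none : MvPolynomial (Option (Fin m)) ℂ) p) =
      MvPolynomial.C (toLaurent p) := by
    intro p
    induction p using Polynomial.induction_on' with
    | add p q hp hq => rw [map_add, map_add, hp, hq, map_add, map_add]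
    | monomial n c =>
      rw [Polynomial.aeval_monomial, map_mul, map_pow, hΨnone, hΨC, MvPolynomial.algebraMap_apply,
        ← LaurentPolynomial.C_eq_algebraMap, ← map_pow, T_pow, mul_one, ← map_mul,
        Polynomial.toLaurent_C_mul_T]
  have hΨY : ∀ i, Ψ (Y i) = MvPolynomial.C (T K) * substForm a i := by
    intro i
    show Ψ (Polynomial.aeval (X none : MvPolynomial (Option (Fin m)) ℂ) (P i none) +
      ∑ j : Fin m, Polynomial.aeval (X none : MvPolynomial (Option (Fin m)) ℂ) (P i (some j)) *
        X (some j)) = _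
    rw [map_add, map_sum, hΨι, hP, substForm, mul_add, Finset.mul_sum, ← map_mul,
      mul_comm (T (K : ℤ)) (a i none)]
    congr 1
    refine Finset.sum_congr rfl fun j _ => ?_
    rw [map_mul, hΨι, hΨsome, hP, ← mul_assoc, ← map_mul, mul_comm (T (K : ℤ))]
  have hΨH : ∀ e, Ψ (H e) =
      MvPolynomial.C (T ((e : ℤ) * K)) * MvPolynomial.aeval (substForm a) (homogeneousComponent e g) := by
    intro e
    rw [hH]
    simp only
    rw [ringHom_aeval Ψ hΨC, (funext hΨY : (fun i => Ψ (Y i)) = fun i =>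
      MvPolynomial.C (T (K : ℤ)) * substForm a i), aeval_mul_homogeneousComponent, ← map_pow, T_pow]
  -- (A) the bookkeeping identity `f = Σ_e [t^{Ke}] H_e`
  have hG : degenerate g a =
      ∑ e ∈ Finset.range (D + 1), MvPolynomial.aeval (substForm a) (homogeneousComponent e g) := by
    unfold degenerate
    conv_lhs => rw [← sum_homogeneousComponent g]
    rw [map_sum]
  have hsum : f = ∑ e ∈ Finset.range (D + 1), fe e := by
    ext μ
    rw [MvPolynomial.coeff_sum, ← (hlim μ).2, hG, MvPolynomial.coeff_sum, laurent_coeff_sum]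
    refine Finset.sum_congr rfl fun e _ => ?_
    have h1 : coeff μ (Ψ (H e)) =
        T ((e : ℤ) * K) * coeff μ (MvPolynomial.aeval (substForm a) (homogeneousComponent e g)) := by
      rw [hΨH, MvPolynomial.coeff_C_mul]
    have h2 : (coeff μ (Ψ (H e))).coeff ((K * e : ℕ) : ℤ) =
        (coeff μ (MvPolynomial.aeval (substForm a) (homogeneousComponent e g))).coeff 0 := by
      rw [h1, coeff_T_mul']
      congr 1
      push_cast
      ring
    rw [← h2, hΨapply]
    exact coeff_coeff_evalT _ μ (K * e)
  -- (B) the cost of each extracted coefficient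
  have hYdeg : ∀ i, degreeOf none (Y i) ≤ 2 * K := fun i => degreeOf_polyForm_le (P i) (hPdeg i)
  have hYcost : ∀ i, complexity (Y i) ≤ (m + 1) * ((2 * K + 1) * (2 * K + 2) + 2) :=
    fun i => complexity_polyForm_le (P i) (hPdeg i)
  have hcost : ∀ e ∈ Finset.range (D + 1), complexity (fe e) ≤ (2 * K * D + 1) *
      ((D + 2) ^ 2 * complexity g + l * (m + 1) * ((2 * K + 1) * (2 * K + 2) + 2) + 2) := by
    intro e he
    have heD : e ≤ D := Nat.lt_succ_iff.1 (Finset.mem_range.1 he)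
    have hHdeg : degreeOf none (H e) ≤ 2 * K * D := by
      refine (degreeOf_aeval_le_mul none Y hYdeg _).trans ?_
      calc (homogeneousComponent e g).totalDegree * (2 * K) ≤ e * (2 * K) :=
            Nat.mul_le_mul_right _ (homogeneousComponent_isHomogeneous e g).totalDegree_le
        _ ≤ D * (2 * K) := Nat.mul_le_mul_right _ heD
        _ = 2 * K * D := by ring
    have hHcost : complexity (H e) ≤
        (D + 2) ^ 2 * complexity g + l * (m + 1) * ((2 * K + 1) * (2 * K + 2) + 2) := by
      refine (complexity_aeval_le _ _).trans (Nat.add_le_add ?_ ?_)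
      · refine (complexity_homogeneousComponent_le_sq_mul g e).trans ?_
        exact Nat.mul_le_mul_right _ (Nat.pow_le_pow_left (by omega) 2)
      · have := Finset.sum_le_sum fun i (_ : i ∈ (Finset.univ : Finset (Fin l))) => hYcost i
        rw [Finset.sum_const, Finset.card_univ, Fintype.card_fin, smul_eq_mul] at this
        simpa [mul_assoc] using this
    refine (complexity_coeff_optionEquivLeft_le (H e) hHdeg (K * e)).trans ?_
    exact Nat.mul_le_mul_left _ (Nat.add_le_add_right hHcost 2)
  -- assemble
  rw [hsum]
  refine (complexity_finset_sum_le _ _).trans ?_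
  rw [Finset.card_range]
  have := Finset.sum_le_sum hcost
  rw [Finset.sum_const, Finset.card_range, smul_eq_mul] at this
  exact Nat.add_le_add_right this _

end PerN

/-! ### Lemma 4.3 -/

/-- **GMQ16 Lemma 4.3** (Bini–Strassen interpolation; Bürgisser 2004): one-parameter degenerations
OF POLYNOMIAL DEGREE of `VP` families are in `VP` — the tree's named statement `GMQ2016.lemma_4_3`,
discharged. [cite: GrochowMulmuleyQiao2016, Lemma 4.3] -/
theorem lemma_4_3_holds : lemma_4_3 := by
  intro l v g f K hl hv hK hg hdeg
  have hD : IsPBounded fun n => (g n).totalDegree := hg.1.2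
  have hL : IsPBounded fun n => complexity (g n) := hg.2
  refine ⟨⟨by simpa using hv, IsPBounded.mono hD fun n => ?_⟩, ?_⟩
  · obtain ⟨a, -, hlim⟩ := hdeg n
    exact totalDegree_le_of_isLimit (g n) (f n) a hlim
  · have c1 := IsPBounded.const 1
    have c2 := IsPBounded.const 2
    have h2K : IsPBounded fun n => 2 * K n := IsPBounded.mul_holds c2 hK
    have hb : IsPBounded fun n => ((g n).totalDegree + 1) * ((2 * K n * (g n).totalDegree + 1) *
        (((g n).totalDegree + 2) ^ 2 * complexity (g n) +
          l n * (v n + 1) * ((2 * K n + 1) * (2 * K n + 2) + 2) + 2)) + ((g n).totalDegree + 1) :=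
      IsPBounded.add_holds
        (IsPBounded.mul_holds (IsPBounded.add_holds hD c1)
          (IsPBounded.mul_holds (IsPBounded.add_holds (IsPBounded.mul_holds h2K hD) c1)
            (IsPBounded.add_holds
              (IsPBounded.add_holds
                (IsPBounded.mul_holds (IsPBounded.pow_holds (IsPBounded.add_holds hD c2) 2) hL)
                (IsPBounded.mul_holds (IsPBounded.mul_holds hl (IsPBounded.add_holds hv c1))
                  (IsPBounded.add_holds
                    (IsPBounded.mul_holds (IsPBounded.add_holds h2K c1) (IsPBounded.add_holds h2K c2))
                    c2)))
              c2)))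
        (IsPBounded.add_holds hD c1)
    exact IsPBounded.mono hb fun n => complexity_le_of_isDegenerationOfDegree (g n) (f n) (hdeg n)

end Literature.Computability.AlgebraicComplexity.GMQ2016
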